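import Mathlib.Combinatorics.SetFamily.FourFunctions
import Mathlib.Combinatorics.SetFamily.Compression.Down
import Mathlib.Tactic
import HarnessLib
import HarnessLib.Audit.Tags
import Summits.CriticalPhenomena.PercolationContinuityZ3.Theorems.PercNearOneGluingNoHeavyLowerTailSahiTypeSetDaykinFace

/-!
# Crossing configurations: the doubled members at any point are again crossing, and their partition differences are TWINS
# (the "first compression step is always good" lemma of the crossing line)

Support file (seat `prim-masterthm-p1`, gen 43; `--supports stmt-CriticalPhenomena-4575`).  One definition (`doubledAt`), theorems otherwise;
no `sorry`, standard axioms.  Memo `run/shared/lean/prim/prim-masterthm/FROM-prim-masterthm-p1-g43-TYPE-SETS.md` §8–§9.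

SETTING.  `P ⊆ 2^F` labelled by `κ : Finset α → ℕ` is CROSSING (the hypothesis of `CrossSignedColouredDaykin3`, for any number of labels): any two members
meet and do not cover `F`, and members with different labels are incomparable.  For a point `x`, the DOUBLED members at `x` are
`doubledAt P x = {S ∈ P : x ∉ S, insert x S ∈ P}`.

RESULTS ([this work]).
* `doubledAt_crossing`: `doubledAt P x` is again crossing inside `F.erase x` (and a member and its `x`-lift carry the same label, `label_insert_eq`).
* `mem_bothLifts_signed_iff` — **in a crossing configuration the only doubled members of the signed family `Z = P ⊔ σP` are the doubled members of `P`
  and their complements** in `F.erase x` (a positive member below a negative one would give a disjoint pair, a negative below a positive a covering pair).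
* `partDiffs_doubledAt_subset_twins` — **every partition difference of the doubled family is a TWIN** of the compatible meets of `Z`: for `a, a'` doubled,
  `a \ a'` and `insert x (a \ a') = (insert x a) \ a'` (same label), `a ∩ a'` and `(insert x a) ∩ (insert x a')`, `(F.erase x) \ (a ∪ a')` and
  `F \ ((insert x a) ∪ a')`… are compatible meets (witnesses written out).
* `signed_config` (the signed family is a type-set configuration, `#Z = 2#P`); `card_le_card_partDiffs_of_crossing_of_mem_singleton` — **LEMMA S1**: a
  crossing configuration with a member of size `1` or `|F|−1` satisfies `#P ≤ #partDiffs` as soon as its doubled family at that point does.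
* `crossing_first_step` — consequently the TWIN INEQUALITY of `…SahiTypeSetDaykinCompress.typeSet_step'` holds at EVERY point `x ∈ F` of a crossing
  configuration as soon as the crossing inequality `#(doubledAt P x) ≤ #partDiffs (F.erase x) (doubledAt P x) κ` holds for the (smaller, crossing) doubled
  family — the first step of every compression sequence is good (memo §9, Lemma S1's engine).
HONEST FRAMING: structural lemmas; `CrossSignedColouredDaykin3` / `PartitionSignedDaykin` remain OPEN. [this work]
-/

namespace Summit.CriticalPhenomena.PercolationContinuityZ3.Theorems.SahiColouredDaykin

open Finset

variable {α : Type*} [DecidableEq α]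

/-- The DOUBLED members of `P` at `x`: `x`-free members whose `x`-lift is also a member. [this work] -/
def doubledAt (P : Finset (Finset α)) (x : α) : Finset (Finset α) := P.filter fun S => x ∉ S ∧ insert x S ∈ P

/-- Unpacking `doubledAt`. [this work] -/
theorem mem_doubledAt {P : Finset (Finset α)} {x : α} {S : Finset α} : S ∈ doubledAt P x ↔ S ∈ P ∧ x ∉ S ∧ insert x S ∈ P := by
  unfold doubledAt; rw [mem_filter]

section crossing

variable {F : Finset α} {P : Finset (Finset α)} {κ : Finset α → ℕ} {x : α}

/-- In a crossing configuration a member and its `x`-lift have the same label. [this work] -/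
theorem label_insert_eq (hinc : ∀ S ∈ P, ∀ T ∈ P, κ S ≠ κ T → ¬ S ⊆ T) {a : Finset α} (ha : a ∈ doubledAt P x) :
    κ (insert x a) = κ a := by
  obtain ⟨haP, _, hxa⟩ := mem_doubledAt.1 ha
  by_contra h
  exact hinc a haP (insert x a) hxa (Ne.symm h) (subset_insert x a)

/-- **The doubled family of a crossing configuration is crossing in `F.erase x`.** [this work] -/
theorem doubledAt_crossing (hPF : ∀ S ∈ P, S ⊆ F) (hmeet : ∀ S ∈ P, ∀ T ∈ P, (S ∩ T).Nonempty) (hcov : ∀ S ∈ P, ∀ T ∈ P, S ∪ T ≠ F)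
    (hinc : ∀ S ∈ P, ∀ T ∈ P, κ S ≠ κ T → ¬ S ⊆ T) :
    (∀ S ∈ doubledAt P x, S ⊆ F.erase x) ∧ (∀ S ∈ doubledAt P x, ∀ T ∈ doubledAt P x, (S ∩ T).Nonempty) ∧
    (∀ S ∈ doubledAt P x, ∀ T ∈ doubledAt P x, S ∪ T ≠ F.erase x) ∧
    (∀ S ∈ doubledAt P x, ∀ T ∈ doubledAt P x, κ S ≠ κ T → ¬ S ⊆ T) := by
  refine ⟨?_, ?_, ?_, ?_⟩
  · intro S hS
    obtain ⟨hSP, hxS, _⟩ := mem_doubledAt.1 hS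
    intro t ht; exact mem_erase.2 ⟨fun h => hxS (h ▸ ht), hPF S hSP ht⟩
  · intro S hS T hT; exact hmeet S (mem_doubledAt.1 hS).1 T (mem_doubledAt.1 hT).1
  · intro S hS T hT hST
    obtain ⟨_, hxS, hxSP⟩ := mem_doubledAt.1 hS
    obtain ⟨hTP, hxT, _⟩ := mem_doubledAt.1 hT
    apply hcov (insert x S) hxSP T hTP
    have hxF : x ∈ F := hPF _ hxSP (mem_insert_self x S)
    rw [insert_union, hST, insert_erase hxF]
  · intro S hS T hT; exact hinc S (mem_doubledAt.1 hS).1 T (mem_doubledAt.1 hT).1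

/-- **Classification of the doubled members of the signed family.**  In a crossing configuration, if `u` and `insert x u` (`x ∉ u`) are both members of
`Z = P ∪ σP`, then either both are positive (so `u ∈ doubledAt P x`) or both are negative (so `(F.erase x) \ u ∈ doubledAt P x`). [this work] -/
theorem mem_bothLifts_signed (hPF : ∀ S ∈ P, S ⊆ F) (hmeet : ∀ S ∈ P, ∀ T ∈ P, (S ∩ T).Nonempty)
    (hcov : ∀ S ∈ P, ∀ T ∈ P, S ∪ T ≠ F) (hx : x ∈ F) {u : Finset α}
    (hu : u ∈ bothLifts (P ∪ P.image (fun S => F \ S)) x) :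
    u ∈ doubledAt P x ∨ (F.erase x) \ u ∈ doubledAt P x := by
  obtain ⟨hxu, huZ, hxuZ⟩ := mem_bothLifts.1 hu
  have huF : u ⊆ F := by
    rcases mem_union_image_sdiff_iff.1 huZ with h | ⟨S, _, hS⟩
    · exact hPF u h
    · rw [← hS]; exact sdiff_subset
  rcases mem_union_image_sdiff_iff.1 huZ with huP | ⟨S, hS, hSu⟩ <;>
    rcases mem_union_image_sdiff_iff.1 hxuZ with hxuP | ⟨T, hT, hTu⟩
  · exact Or.inl (mem_doubledAt.2 ⟨huP, hxu, hxuP⟩)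
  · -- u positive, insert x u = F \ T negative: u ∩ T = ∅
    exfalso
    have hne := hmeet u huP T hT
    have : u ∩ T = ∅ := by
      ext t; simp only [mem_inter, notMem_empty, iff_false, not_and]
      intro htu htT
      have : t ∈ F \ T := by rw [hTu]; exact mem_insert_of_mem htu
      exact (mem_sdiff.1 this).2 htT
    rw [this] at hne; exact Finset.not_nonempty_empty hne
  · -- u = F \ S negative, insert x u positive: S ∪ insert x u = F
    exfalso
    apply hcov S hS (insert x u) hxuP
    ext t
    constructor
    · intro ht; rcases mem_union.1 ht with h | h
      · exact hPF S hS h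
      · rcases mem_insert.1 h with rfl | h; exacts [hx, huF h]
    · intro htF
      by_cases htS : t ∈ S
      · exact mem_union_left _ htS
      · have : t ∈ F \ S := mem_sdiff.2 ⟨htF, htS⟩
        rw [hSu] at this; exact mem_union_right _ (mem_insert_of_mem this)
  · -- both negative: u = F \ S, insert x u = F \ T; the doubled member of P is T = (F.erase x) \ u with insert x T = S
    right
    have hTF := hPF T hT
    have hSF := hPF S hS
    have hT' : (F.erase x) \ u = T := by
      rw [erase_sdiff_eq_sdiff_insert, ← hTu, Finset.sdiff_sdiff_eq_self hTF]
    have hS' : F \ u = S := by rw [← hSu, Finset.sdiff_sdiff_eq_self hSF]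
    rw [hT']
    refine mem_doubledAt.2 ⟨hT, ?_, ?_⟩
    · intro hxT
      have : x ∈ F \ T := by rw [hTu]; exact mem_insert_self x u
      exact (mem_sdiff.1 this).2 hxT
    · have : insert x T = S := by rw [← hT', insert_erase_sdiff_eq hx hxu, hS']
      rw [this]; exact hS

/-- **Partition differences of the doubled family are twins.**  [this work] -/
theorem partDiffs_doubledAt_subset_twins (hPF : ∀ S ∈ P, S ⊆ F) (hcf : ∀ S ∈ P, F \ S ∉ P)
    (hinc : ∀ S ∈ P, ∀ T ∈ P, κ S ≠ κ T → ¬ S ⊆ T) (hx : x ∈ F) :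
    partDiffs (F.erase x) (doubledAt P x) κ ⊆
      bothLifts (typeMeets (P ∪ P.image (fun S => F \ S)) (signedTypes F P κ)) x := by
  intro w hw
  set Z := P ∪ P.image (fun S => F \ S) with hZ
  set L := signedTypes F P κ with hL
  -- helpers: membership in typeMeets from explicit witnesses
  have posZ : ∀ {S}, S ∈ P → S ∈ Z := fun h => mem_union_left _ h
  have negZ : ∀ {S}, S ∈ P → F \ S ∈ Z := fun h => mem_union_right _ (mem_image_of_mem _ h)
  have Lpos : ∀ {S}, S ∈ P → L S = {(κ S, true)} := fun h => signedTypes_of_mem hcf h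
  have Lneg : ∀ {S}, S ∈ P → L (F \ S) = {(κ S, false)} := fun h => signedTypes_of_sdiff_mem hPF hcf h
  have mkMM : ∀ {z z' : Finset α} {t t' : ℕ × Bool}, z ∈ Z → z' ∈ Z → L z = {t} → L z' = {t'} → tcompat t t' = true →
      z ∩ z' ∈ typeMeets Z L := by
    intro z z' t t' hz hz' h1 h2 htt
    exact mem_typeMeets_iff.2 ⟨z, hz, z', hz', (lcompat_iff _ _).2 ⟨t, by rw [h1]; exact mem_singleton_self _,
      t', by rw [h2]; exact mem_singleton_self _, htt⟩, rfl⟩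
  have tc : ∀ (c c' : ℕ) (b b' : Bool), tcompat (c, b) (c', b') = true ↔ (c = c' ↔ b ≠ b') := fun c c' b b' => tcompat_eq_true_iff _ _
  unfold partDiffs at hw
  simp only [mem_union, mem_image, mem_filter, mem_product, Prod.exists] at hw
  rcases hw with ⟨a, a', ⟨⟨ha, ha'⟩, hκ⟩, rfl⟩ | ⟨a, a', ⟨⟨ha, ha'⟩, hκ⟩, rfl⟩ | ⟨a, a', ⟨⟨ha, ha'⟩, hκ⟩, rfl⟩
  · -- same label: a \ a' and insert x (a \ a')
    obtain ⟨haP, hxa, hxaP⟩ := mem_doubledAt.1 ha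
    obtain ⟨ha'P, hxa', _⟩ := mem_doubledAt.1 ha'
    have hk : κ (insert x a) = κ a := label_insert_eq hinc ha
    refine mem_bothLifts.2 ⟨fun h => hxa (mem_sdiff.1 h).1, ?_, ?_⟩
    · have e : a \ a' = a ∩ (F \ a') := by
        ext t; have := fun (h : t ∈ a) => hPF a haP h
        simp only [mem_sdiff, mem_inter]; tauto
      rw [e]; exact mkMM (posZ haP) (negZ ha'P) (Lpos haP) (Lneg ha'P) ((tc _ _ _ _).2 ⟨fun _ => by decide, fun _ => hκ⟩)
    · have e : insert x (a \ a') = (insert x a) ∩ (F \ a') := by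
        ext t; have h1 := fun (h : t ∈ a) => hPF a haP h
        simp only [mem_insert, mem_sdiff, mem_inter]
        constructor
        · rintro (rfl | ⟨hta, hta'⟩)
          · exact ⟨Or.inl rfl, hx, hxa'⟩
          · exact ⟨Or.inr hta, h1 hta, hta'⟩
        · rintro ⟨rfl | hta, _, hta'⟩
          · exact Or.inl rfl
          · exact Or.inr ⟨hta, hta'⟩
      rw [e]; exact mkMM (posZ hxaP) (negZ ha'P) (Lpos hxaP) (Lneg ha'P) ((tc _ _ _ _).2 ⟨fun _ => by decide, fun _ => hk.trans hκ⟩)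
  · -- different labels: a ∩ a' and insert x (a ∩ a') = (insert x a) ∩ (insert x a')
    obtain ⟨haP, hxa, hxaP⟩ := mem_doubledAt.1 ha
    obtain ⟨ha'P, _, hxa'P⟩ := mem_doubledAt.1 ha'
    have hk : κ (insert x a) = κ a := label_insert_eq hinc ha
    have hk' : κ (insert x a') = κ a' := label_insert_eq hinc ha'
    refine mem_bothLifts.2 ⟨fun h => hxa (mem_inter.1 h).1, ?_, ?_⟩
    · exact mkMM (posZ haP) (posZ ha'P) (Lpos haP) (Lpos ha'P) ((tc _ _ _ _).2 ⟨fun h => absurd h hκ, fun h => absurd rfl h⟩)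
    · have e : insert x (a ∩ a') = insert x a ∩ insert x a' := by
        ext t; simp only [mem_insert, mem_inter]; tauto
      rw [e]
      exact mkMM (posZ hxaP) (posZ hxa'P) (Lpos hxaP) (Lpos hxa'P)
        ((tc _ _ _ _).2 ⟨fun h => absurd (hk.symm.trans (h.trans hk')) hκ, fun h => absurd rfl h⟩)
  · -- different labels: (F.erase x) \ (a ∪ a') = (F \ insert x a) ∩ (F \ a')  and  insert x of it = (F \ a) ∩ (F \ a')
    obtain ⟨haP, hxa, hxaP⟩ := mem_doubledAt.1 ha
    obtain ⟨ha'P, hxa', _⟩ := mem_doubledAt.1 ha'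
    have hk : κ (insert x a) = κ a := label_insert_eq hinc ha
    refine mem_bothLifts.2 ⟨fun h => (mem_erase.1 (mem_sdiff.1 h).1).1 rfl, ?_, ?_⟩
    · have e : (F.erase x) \ (a ∪ a') = (F \ insert x a) ∩ (F \ a') := by
        ext t; simp only [mem_sdiff, mem_erase, mem_union, mem_insert, mem_inter]; tauto
      rw [e]
      exact mkMM (negZ hxaP) (negZ ha'P) (Lneg hxaP) (Lneg ha'P)
        ((tc _ _ _ _).2 ⟨fun h => absurd (hk.symm.trans h) hκ, fun h => absurd rfl h⟩)
    · have e : insert x ((F.erase x) \ (a ∪ a')) = (F \ a) ∩ (F \ a') := by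
        ext t; simp only [mem_insert, mem_sdiff, mem_erase, mem_union, mem_inter]
        constructor
        · rintro (rfl | ⟨⟨htx, htF⟩, hnot⟩)
          · exact ⟨⟨hx, hxa⟩, hx, hxa'⟩
          · exact ⟨⟨htF, fun h => hnot (Or.inl h)⟩, htF, fun h => hnot (Or.inr h)⟩
        · rintro ⟨⟨htF, hta⟩, _, hta'⟩
          by_cases htx : t = x
          · exact Or.inl htx
          · exact Or.inr ⟨⟨htx, htF⟩, fun h => h.elim hta hta'⟩
      rw [e]
      exact mkMM (negZ haP) (negZ ha'P) (Lneg haP) (Lneg ha'P) ((tc _ _ _ _).2 ⟨fun h => absurd h hκ, fun h => absurd rfl h⟩)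

/-- Doubled members of the signed family: complements of doubled members of `P` are doubled. [this work] -/
theorem sdiff_mem_bothLifts_signed (hx : x ∈ F) {a : Finset α} (ha : a ∈ doubledAt P x) :
    (F.erase x) \ a ∈ bothLifts (P ∪ P.image (fun S => F \ S)) x := by
  obtain ⟨haP, hxa, hxaP⟩ := mem_doubledAt.1 ha
  refine mem_bothLifts.2 ⟨fun h => (mem_erase.1 (mem_sdiff.1 h).1).1 rfl, ?_, ?_⟩
  · rw [erase_sdiff_eq_sdiff_insert]; exact mem_union_right _ (mem_image_of_mem _ hxaP)
  · rw [insert_erase_sdiff_eq hx hxa]; exact mem_union_right _ (mem_image_of_mem _ haP)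

/-- Doubled members of `P` are doubled members of the signed family. [this work] -/
theorem mem_bothLifts_signed_of_doubledAt {a : Finset α} (ha : a ∈ doubledAt P x) :
    a ∈ bothLifts (P ∪ P.image (fun S => F \ S)) x := by
  obtain ⟨haP, hxa, hxaP⟩ := mem_doubledAt.1 ha
  exact mem_bothLifts.2 ⟨hxa, mem_union_left _ haP, mem_union_left _ hxaP⟩

/-- **The first compression step of a crossing configuration is good.**  If the crossing inequality holds for the doubled family at `x`
(`#(doubledAt P x) ≤ #partDiffs (F.erase x) (doubledAt P x) κ` — an instance on fewer points), then the twin inequality required by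
`typeSet_step'` holds at `x` for the signed family of `P`: every doubled member of the signed family has weight `1 + 1` above and `1` below, there are
exactly `2·#(doubledAt P x)` of them, and the partition differences of the doubled family are twins. [this work] -/
theorem crossing_first_step (hPF : ∀ S ∈ P, S ⊆ F) (hcf : ∀ S ∈ P, F \ S ∉ P) (hmeet : ∀ S ∈ P, ∀ T ∈ P, (S ∩ T).Nonempty)
    (hcov : ∀ S ∈ P, ∀ T ∈ P, S ∪ T ≠ F) (hinc : ∀ S ∈ P, ∀ T ∈ P, κ S ≠ κ T → ¬ S ⊆ T) (hx : x ∈ F)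
    (hA : #(doubledAt P x) ≤ #(partDiffs (F.erase x) (doubledAt P x) κ)) :
    ∑ u ∈ bothLifts (P ∪ P.image (fun S => F \ S)) x,
        (tsWeight (signedTypes F P κ u) + tsWeight (signedTypes F P κ (insert x u))) ≤
      ∑ u ∈ bothLifts (P ∪ P.image (fun S => F \ S)) x,
        tsWeight (projTypes (P ∪ P.image (fun S => F \ S)) (signedTypes F P κ) x u) +
      2 * #(bothLifts (typeMeets (P ∪ P.image (fun S => F \ S)) (signedTypes F P κ)) x) := by
  set Z := P ∪ P.image (fun S => F \ S) with hZ
  set L := signedTypes F P κ with hL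
  set D := bothLifts Z x with hD
  set A := doubledAt P x with hAdef
  -- every weight is 1: type-sets are singletons, and the union type-set of a doubled member is again a singleton
  have Lpos : ∀ {S}, S ∈ P → L S = {(κ S, true)} := fun h => signedTypes_of_mem hcf h
  have Lneg : ∀ {S}, S ∈ P → L (F \ S) = {(κ S, false)} := fun h => signedTypes_of_sdiff_mem hPF hcf h
  have w1 : ∀ (c : ℕ) (b : Bool), tsWeight ({(c, b)} : Finset (ℕ × Bool)) = 1 := by
    intro c b; unfold tsWeight
    have : lcompat ({(c, b)} : Finset (ℕ × Bool)) {(c, b)} ≠ true := by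
      intro hh
      rw [lcompat_iff] at hh
      obtain ⟨t, ht, u, hu, h⟩ := hh
      rw [mem_singleton] at ht hu; subst ht; subst hu
      rw [tcompat_eq_true_iff] at h; exact (h.1 rfl) rfl
    rw [if_neg this]
  -- classification of D
  have hDmem : ∀ u ∈ D, (u ∈ A ∧ L u = {(κ u, true)} ∧ L (insert x u) = {(κ u, true)}) ∨
      ((F.erase x) \ u ∈ A ∧ ∃ c : ℕ, L u = {(c, false)} ∧ L (insert x u) = {(c, false)}) := by
    intro u hu
    rcases mem_bothLifts_signed hPF hmeet hcov hx hu with h | h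
    · left
      have hk := label_insert_eq hinc h
      obtain ⟨huP, _, hxuP⟩ := mem_doubledAt.1 h
      exact ⟨h, Lpos huP, by rw [Lpos hxuP, hk]⟩
    · right
      refine ⟨h, ?_⟩
      obtain ⟨hTP, hxT, hxTP⟩ := mem_doubledAt.1 h
      have hxu : x ∉ u := (mem_bothLifts.1 hu).1
      have huF : u ⊆ F := by
        obtain ⟨_, huZ, _⟩ := mem_bothLifts.1 hu
        rcases mem_union_image_sdiff_iff.1 huZ with h' | ⟨S, _, hS⟩
        · exact hPF u h'
        · rw [← hS]; exact sdiff_subset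
      -- u = F \ insert x T', insert x u = F \ T' with T' = (F.erase x) \ u
      have e1 : F \ (insert x ((F.erase x) \ u)) = u := by
        rw [insert_erase_sdiff_eq hx hxu, Finset.sdiff_sdiff_eq_self huF]
      have e2 : F \ ((F.erase x) \ u) = insert x u := by
        rw [erase_sdiff_eq_sdiff_insert, Finset.sdiff_sdiff_eq_self (insert_subset hx huF)]
      have hk := label_insert_eq hinc h
      refine ⟨κ ((F.erase x) \ u), ?_, ?_⟩
      · have := Lneg hxTP; rw [e1, hk] at this; exact this
      · have := Lneg hTP; rw [e2] at this; exact this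
  -- LHS = 2 · #D, first RHS sum = #D
  have hLHS : ∑ u ∈ D, (tsWeight (L u) + tsWeight (L (insert x u))) = 2 * #D := by
    rw [show 2 * #D = ∑ u ∈ D, 2 by rw [sum_const, smul_eq_mul, mul_comm]]
    refine sum_congr rfl fun u hu => ?_
    rcases hDmem u hu with ⟨_, h1, h2⟩ | ⟨_, c, h1, h2⟩ <;> rw [h1, h2, w1]
  have hRHS1 : ∑ u ∈ D, tsWeight (projTypes Z L x u) = #D := by
    rw [card_eq_sum_ones]
    refine sum_congr rfl fun u hu => ?_
    obtain ⟨_, huZ, hxuZ⟩ := mem_bothLifts.1 hu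
    have ep : projTypes Z L x u = L u ∪ L (insert x u) := by unfold projTypes; rw [if_pos huZ, if_pos hxuZ]
    rcases hDmem u hu with ⟨_, h1, h2⟩ | ⟨_, c, h1, h2⟩ <;> rw [ep, h1, h2, union_self, w1]
  -- #D = 2 · #A : D = A ⊔ σ'A
  have hDeq : D = A ∪ A.image (fun a => (F.erase x) \ a) := by
    ext u; constructor
    · intro hu
      rcases mem_bothLifts_signed hPF hmeet hcov hx hu with h | h
      · exact mem_union_left _ h
      · refine mem_union_right _ (mem_image.2 ⟨(F.erase x) \ u, h, ?_⟩)
        have hxu : x ∉ u := (mem_bothLifts.1 hu).1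
        have huF : u ⊆ F := by
          obtain ⟨_, huZ, _⟩ := mem_bothLifts.1 hu
          rcases mem_union_image_sdiff_iff.1 huZ with h' | ⟨S, _, hS⟩
          · exact hPF u h'
          · rw [← hS]; exact sdiff_subset
        have : u ⊆ F.erase x := fun t ht => mem_erase.2 ⟨fun h => hxu (h ▸ ht), huF ht⟩
        exact Finset.sdiff_sdiff_eq_self this
    · intro hu
      rcases mem_union.1 hu with h | h
      · exact mem_bothLifts_signed_of_doubledAt h
      · obtain ⟨a, ha, rfl⟩ := mem_image.1 h
        exact sdiff_mem_bothLifts_signed hx ha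
  have hdisj : Disjoint A (A.image fun a => (F.erase x) \ a) := by
    rw [disjoint_left]; intro a ha ha'
    obtain ⟨a', ha', hEq⟩ := mem_image.1 ha'
    -- a' and a = (F.erase x) \ a' are both in P and disjoint: contradiction with meeting
    have hne := hmeet a' (mem_doubledAt.1 ha').1 a (mem_doubledAt.1 ha).1
    rw [← hEq, inter_sdiff_self] at hne
    exact Finset.not_nonempty_empty hne
  have hinj : Set.InjOn (fun a => (F.erase x) \ a) ↑A := by
    intro a ha a' ha' h
    have h1 := (doubledAt_crossing (x := x) hPF hmeet hcov hinc).1 a (mem_coe.1 ha)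
    have h2 := (doubledAt_crossing (x := x) hPF hmeet hcov hinc).1 a' (mem_coe.1 ha')
    have : (F.erase x) \ ((F.erase x) \ a) = (F.erase x) \ ((F.erase x) \ a') := by simp only at h; rw [h]
    rwa [Finset.sdiff_sdiff_eq_self h1, Finset.sdiff_sdiff_eq_self h2] at this
  have hcardD : #D = 2 * #A := by
    rw [hDeq, card_union_of_disjoint hdisj, card_image_of_injOn hinj]; ring
  -- twins ≥ #partDiffs(A) ≥ #A
  have htw : #A ≤ #(bothLifts (typeMeets Z L) x) :=
    hA.trans (card_le_card (partDiffs_doubledAt_subset_twins hPF hcf hinc hx))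
  rw [hLHS, hRHS1]
  omega

/-- The signed family of a labelled complement-free `P ⊆ 2^F` is a type-set configuration on `F` (the four hypotheses of `TypeSetSignedDaykin`),
with `#Z = 2·#P` and compatible meets inside `partDiffs`. [this work] -/
theorem signed_config (hPF : ∀ S ∈ P, S ⊆ F) (hcf : ∀ S ∈ P, F \ S ∉ P) :
    (∀ z ∈ P ∪ P.image (fun S => F \ S), z ⊆ F) ∧
    (∀ z ∈ P ∪ P.image (fun S => F \ S), F \ z ∈ P ∪ P.image (fun S => F \ S)) ∧
    (∀ z ∈ P ∪ P.image (fun S => F \ S), (signedTypes F P κ z).Nonempty) ∧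
    (∀ z ∈ P ∪ P.image (fun S => F \ S), signedTypes F P κ (F \ z) = (signedTypes F P κ z).image flipT) ∧
    #(P ∪ P.image (fun S => F \ S)) = 2 * #P := by
  refine ⟨?_, ?_, ?_, ?_, ?_⟩
  · intro z hz
    rcases mem_union_image_sdiff_iff.1 hz with hzP | ⟨S, _, rfl⟩
    · exact hPF z hzP
    · exact sdiff_subset
  · intro z hz
    rcases mem_union_image_sdiff_iff.1 hz with hzP | ⟨S, hS, rfl⟩
    · exact mem_union.2 (Or.inr (mem_image.2 ⟨z, hzP, rfl⟩))
    · rw [Finset.sdiff_sdiff_eq_self (hPF S hS)]; exact mem_union.2 (Or.inl hS)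
  · intro z hz
    rcases mem_union_image_sdiff_iff.1 hz with hzP | ⟨S, hS, rfl⟩
    · rw [signedTypes_of_mem hcf hzP]; exact singleton_nonempty _
    · rw [signedTypes_of_sdiff_mem hPF hcf hS]; exact singleton_nonempty _
  · intro z hz
    rcases mem_union_image_sdiff_iff.1 hz with hzP | ⟨S, hS, rfl⟩
    · rw [signedTypes_of_mem hcf hzP, signedTypes_of_sdiff_mem hPF hcf hzP, image_singleton]; rfl
    · rw [Finset.sdiff_sdiff_eq_self (hPF S hS), signedTypes_of_mem hcf hS, signedTypes_of_sdiff_mem hPF hcf hS, image_singleton]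
      simp [flipT]
  · have hdisj : Disjoint P (P.image fun S => F \ S) := by
      rw [disjoint_left]
      intro S hS hSN
      obtain ⟨S', hS', hSS'⟩ := mem_image.1 hSN
      exact hcf S' hS' (hSS' ▸ hS)
    have hinj : Set.InjOn (fun S => F \ S) ↑P := by
      intro S hS S' hS' hSS'
      have h1 := hPF S (mem_coe.1 hS); have h2 := hPF S' (mem_coe.1 hS')
      have : F \ (F \ S) = F \ (F \ S') := by simp only at hSS'; rw [hSS']
      rwa [Finset.sdiff_sdiff_eq_self h1, Finset.sdiff_sdiff_eq_self h2] at this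
    rw [card_union_of_disjoint hdisj, card_image_of_injOn hinj]; ring

/-- **LEMMA S1 (one step).**  For a crossing labelled configuration `P ⊆ 2^F` having a member of size `1` or `|F| − 1` — `{x} ∈ P` or `F.erase x ∈ P` —
the inequality `#P ≤ #partDiffs F P κ` follows from the same inequality for the (crossing, smaller) doubled family at `x`.  Proof: the compression at
`x` is good (`crossing_first_step`), the projection contains `∅` so the face theorem
(`card_add_card_filter_le_two_mul_card_typeMeets_of_empty_mem`) gives the inequality for it, and `typeSet_step'` assembles. [this work] -/
theorem card_le_card_partDiffs_of_crossing_of_mem_singleton (hPF : ∀ S ∈ P, S ⊆ F) (hcf : ∀ S ∈ P, F \ S ∉ P)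
    (hmeet : ∀ S ∈ P, ∀ T ∈ P, (S ∩ T).Nonempty) (hcov : ∀ S ∈ P, ∀ T ∈ P, S ∪ T ≠ F)
    (hinc : ∀ S ∈ P, ∀ T ∈ P, κ S ≠ κ T → ¬ S ⊆ T) (hx : x ∈ F) (hsing : {x} ∈ P ∨ F.erase x ∈ P)
    (hA : #(doubledAt P x) ≤ #(partDiffs (F.erase x) (doubledAt P x) κ)) :
    #P ≤ #(partDiffs F P κ) := by
  set Z := P ∪ P.image (fun S => F \ S) with hZ
  set L := signedTypes F P κ with hL
  obtain ⟨hZG, hcc, hne, hflip, hcardZ⟩ := signed_config (κ := κ) hPF hcf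
  -- the projection at x is a configuration on F.erase x containing ∅
  obtain ⟨hZG', hcc', hne', hflip'⟩ := projTypes_config (Z := Z) (L := L) hx hZG hcc hne hflip
  have h0 : (∅ : Finset α) ∈ Z.image (fun s => s.erase x) := by
    rcases hsing with h | h
    · exact mem_image.2 ⟨{x}, mem_union_left _ h, by simp⟩
    · refine mem_image.2 ⟨F \ F.erase x, mem_union_right _ (mem_image_of_mem _ h), ?_⟩
      rw [sdiff_erase_self hx]; simp
  have hIH := card_add_card_filter_le_two_mul_card_typeMeets_of_empty_mem hZG' hcc' hne' hflip' h0
  have htw := crossing_first_step (κ := κ) hPF hcf hmeet hcov hinc hx hA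
  have key := typeSet_step' (Z := Z) (L := L) (y := x) hIH htw
  have hsub := card_le_card (typeMeets_signed_subset_partDiffs (κ := κ) hPF hcf)
  have : 2 * #P ≤ 2 * #(partDiffs F P κ) :=
    calc 2 * #P = #Z := hcardZ.symm
      _ ≤ #Z + #(Z.filter fun z => lcompat (L z) (L z) = true) := Nat.le_add_right _ _
      _ ≤ 2 * #(typeMeets Z L) := key
      _ ≤ 2 * #(partDiffs F P κ) := Nat.mul_le_mul_left 2 hsub
  omega

end crossing

end Summit.CriticalPhenomena.PercolationContinuityZ3.Theorems.SahiColouredDaykin
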